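import Summits.QuantumFields.YangMills.Theorems.AlphaInputsT3ACv2
import Summits.QuantumFields.YangMills.Theorems.AlphaInputsT3ACEnvelope
import Literature.MathematicalPhysics.QuantumFieldTheory.Balaban1983to89.T3SmallLiftHistory
import HarnessLib

/-!
# `AlphaInputsT3ACv2Data` — THE VERSION-2 PACKAGE'S DATA ASSEMBLED into the Literature interface `T3AlphaInputsAC.AlphaDataT3 F γ` WITH PRINT'S
# (40) SUPPORT AS ADMISSIBILITY (`OfV2.dataT3c`), and the schemas it delivers: the MINIMISER ROWS `Constraint42Top`, `Regularity68Levels`/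
# `Regularity68`, the `UminTrivIsRegMinimiser` clauses at every height `n < K`, `MainTermIsAction`, `AdmOnSmall`; the SANDWICH `Ineq41AE`/`Ineq47AE`
# (all `j ≤ K`) with `EnvelopeRegular` AT EVERY `j ≤ K` (the terminal rows close the top level); `ChiRange`, `TrivRegions`, `RmSize`, `EcstBook` (i)

Lane `pub-balaban3d`, seat alpha-1 (route owner RULING g16-№2; interface desk lit-balaban typer g41 PEN ANSWER 2026-08-26T23:19:50Z).  Under
`AlphaInputsT3AC.OfV2 F 𝔠` (previous file) the package's data at `(γ, K)` are `h.pkgAtV2 γ hγ hγ1 K : PkgAtV2` (v1 record + [7] constants + rows);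
`dataT3c` reads them exactly as part 2's `dataT3` reads `pkgAt`, except `Adm K j h W := ChargedT3 … j h W` — print's (40) support (admissible
history, datum plaquettes in `Ω_j(h)` below `2L²·B·θBal(K − j + 1)`, `B = avgWindowFactor L = 151L²`), the guard of the rows r2/r3.  Every theorem of parts 1–4 that is a `PkgAt`-level
fact (`resDensity_le_ae`, `mainT_eq`, `Rm_eq`, `eps1_eq`, `θBal_pos`, …) is reused through `PkgAtV2.toPkgAt`.  HONESTY: the tower's `LF` still
charges the lane's FLOORED trivial mass outside `ChargedT3` (seat finding F-α1-3; repair = un-floor the trivial mass, owner's call), so `LFShape`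
is NOT claimed for `dataT3c`; the polymer clauses, `PintSize`, `EcstBook` (ii), `RepAtHeights`, the `n = K` clause of `UminTrivIsRegMinimiser`
(seat finding F-α1-6) and the large-field clauses of the 18916 Full package are not delivered here.  CONDITIONAL on the package; nothing of
[Balaban1985UV3]/[Balaban1985Variational] is asserted.

References: T. Bałaban, Commun. Math. Phys. 102 (1985) 255–275 [Balaban1985UV3], (40)–(43) p.266, (47) p.267, (62)–(68) pp.271–273, Thm 2 p.272;
Commun. Math. Phys. 102 (1985) 277–309 [Balaban1985Variational], (6)–(8) and Thm 1 p.278–279, Prop 7 p.299.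
-/

set_option autoImplicit false

noncomputable section

namespace Summit.QuantumFields.YangMills.Theorems

open MeasureTheory
open Literature.MathematicalPhysics.QuantumFieldTheory.Balaban1983to89
open Literature.MathematicalPhysics.QuantumFieldTheory.Balaban1983to89.T3ContinuumYM3Torus
open Literature.MathematicalPhysics.QuantumFieldTheory.Balaban1983to89.T3UnitLawDensityEML (ℰp)
open Literature.MathematicalPhysics.QuantumFieldTheory.Balaban1983to89.T3UnitScaleTilt (θBal)
open Literature.MathematicalPhysics.QuantumFieldTheory.Balaban1983to89.T3LevelShift (fieldShift)
open Literature.MathematicalPhysics.QuantumFieldTheory.Balaban1983to89.T3PrintedRegularMinimiser (regFibrePr minActionRegPr)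
open Literature.MathematicalPhysics.QuantumFieldTheory.Balaban1983to89.T3AlphaInputsAC
open Literature.MathematicalPhysics.QuantumFieldTheory.Balaban1983to89.T3SmallLiftHistory (sqrt_inv_mul_θBal_le_succ)
open Literature.MathematicalPhysics.QuantumFieldTheory.Balaban1985CMP102
open Literature.MathematicalPhysics.QuantumFieldTheory.Balaban1985CMP102.Setting
open Summit.QuantumFields.Balaban3D.Carriers
open Summit.QuantumFields.Balaban3D.Proofs.Primitives
open Summit.QuantumFields.Balaban3D.Proofs.TowerAC
open Summit.QuantumFields.Balaban3D.Proofs.StandardAC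
open Summit.QuantumFields.Balaban3D.Proofs.InputsAC
open Summit.QuantumFields.Balaban3D.Proofs.TowerFactsAC
open Summit.QuantumFields.Balaban3D.Proofs.TransportAC (integrable_mul_exp_of_le)
open Summit.QuantumFields.Balaban3D.Proofs (Bound55Std.measurable_actionEta Bound55Std.actionEta_nonneg)

/-! ## §0 Two bookkeeping facts: the route's window inside print's (40) window; integrability of the (41)-summands from the data rows -/

/-- **THE ROUTE'S WINDOW SITS INSIDE PRINT'S (40) WINDOW ONE LEVEL UP**: `θBal(i) ≤ 2L²·θBal(i + 1)` (`θ(i+1) ≥ L^{−1/2}θ(i)`, tree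
`T3SmallLiftHistory.sqrt_inv_mul_θBal_le_succ`, and `√L ≤ 2L²`; `0 < γ ≤ 1`, `L ≥ 1`, `b₀ > 0`, `p₀ ≥ 0`). [cite: Balaban1985UV3, (7) p.257 and (40) p.266] -/
theorem θBal_le_two_mul_sq_mul_θBal_succ {L : ℕ} (hL : 1 ≤ L) {γ b₀ p₀ : ℝ} (hγ : 0 < γ) (hγ1 : γ ≤ 1) (hb : 0 < b₀) (hp : 0 ≤ p₀)
    (i : ℕ) : θBal L γ b₀ p₀ i ≤ 2 * (L : ℝ) ^ 2 * θBal L γ b₀ p₀ (i + 1) := by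
  have hL' : (1 : ℝ) ≤ L := by exact_mod_cast hL
  have hs : 0 < Real.sqrt ((L : ℝ)⁻¹) := Real.sqrt_pos.2 (inv_pos.mpr (by linarith))
  have h1 := sqrt_inv_mul_θBal_le_succ hL hγ hγ1 hb.le hp i
  have hθ1 : 0 ≤ θBal L γ b₀ p₀ (i + 1) := (T3MinimiserStabilityReduction.θBal_pos hL hγ hγ1 hb p₀ (i + 1)).le
  have h2 : θBal L γ b₀ p₀ i ≤ (Real.sqrt ((L : ℝ)⁻¹))⁻¹ * θBal L γ b₀ p₀ (i + 1) := by
    rw [le_inv_mul_iff₀ hs]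
    exact h1
  have h3 : (Real.sqrt ((L : ℝ)⁻¹))⁻¹ ≤ 2 * (L : ℝ) ^ 2 := by
    rw [Real.sqrt_inv, inv_inv]
    have hL1 : (L : ℝ) ≤ (L : ℝ) ^ 2 := by nlinarith
    have hL2 : (L : ℝ) ^ 2 ≤ (2 * (L : ℝ) ^ 2) ^ 2 := by nlinarith [sq_nonneg ((L : ℝ) ^ 2)]
    calc Real.sqrt (L : ℝ) ≤ Real.sqrt ((2 * (L : ℝ) ^ 2) ^ 2) := Real.sqrt_le_sqrt (hL1.trans hL2)
      _ = 2 * (L : ℝ) ^ 2 := Real.sqrt_sq (by positivity)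
  exact h2.trans (mul_le_mul_of_nonneg_right h3 hθ1)

section Integrability

variable {F : T3Family} {𝔠 : AlphaConsts F.L (suGroupModel 2).N} {γ : ℝ} {hγ : 0 < γ} {hγ1 : γ ≤ (min 𝔠.gamma0 1) ^ 2} {K : ℕ}
  (p : AlphaInputsT3AC.PkgAt F 𝔠 γ hγ hγ1 K)

/-- **THE (41)-MAJORANT OF A v1 PACKAGE RECORD IS INTEGRABLE AT LEVEL `j` GIVEN THE THREE DATA ROWS THERE**: `Σ_h m_j(h,·)·exp(−mainT + Pint + Zterm)`
is integrable as soon as `U_j(·, h)` is measurable and `Pint_j(h, ·)` is measurable and bounded above (masses integrable, `mainT ≥ 0` measurable) —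
part 2's `dataT3_integrable_up` with the rows abstracted (so that both the step rows, `j < K`, and the terminal rows, `j = K`, feed it).
[cite: Balaban1985UV3, (41) p.266] -/
theorem AlphaInputsT3AC.PkgAt.integrable_up_of_rows (j : ℕ) (hU : ∀ h : Hist (F.P K) j, Measurable (p.UkH j h))
    (hPm : ∀ h : Hist (F.P K) j, Measurable ((inputOfAC 𝔠.lane p.X p.𝔖).Pint j h)) (cP : ℝ)
    (hPb : ∀ (h : Hist (F.P K) j) (U : GaugeField (F.P K) j (Matrix.specialUnitaryGroup (Fin 2) ℂ)), (inputOfAC 𝔠.lane p.X p.𝔖).Pint j h U ≤ cP) :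
    Integrable (fun W => ∑ hh : Hist (F.P K) j, (inputOfAC 𝔠.lane p.X p.𝔖).W.mass j hh W *
      Real.exp (-(p.T.mainT j hh W) + p.T.Pint j hh W + p.T.Zterm j hh))
      (fieldMeasure (F.P K) j (Matrix.specialUnitaryGroup (Fin 2) ℂ)) := by
  refine integrable_finsetSum _ fun hh _ => ?_
  have hmain : ∀ W : GaugeField (F.P K) j (Matrix.specialUnitaryGroup (Fin 2) ℂ), p.T.mainT j hh W =
      ((T3Scales F γ hγ (hγ1.trans (sq_min_one_le _ 𝔠.gamma0_pos)) K).gk j)⁻¹ ^ 2 *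
        (T3Scales F γ hγ (hγ1.trans (sq_min_one_le _ 𝔠.gamma0_pos)) K).actionEta j (p.UkH j hh W) := fun _ => rfl
  refine integrable_mul_exp_of_le (stdTowerInputAC_mass_integrable p.X 𝔠.lane.carrier p.𝔖 j hh) ?_ (c := cP + p.T.Zterm j hh) ?_
  · simp_rw [hmain]
    exact ((measurable_const.mul ((Bound55Std.measurable_actionEta
      (S := T3Scales F γ hγ (hγ1.trans (sq_min_one_le _ 𝔠.gamma0_pos)) K) j).comp (hU hh))).neg.add (hPm hh)).add measurable_const
  · intro W
    have h0 : 0 ≤ p.T.mainT j hh W := by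
      rw [hmain]
      exact mul_nonneg (sq_nonneg _) (Bound55Std.actionEta_nonneg (S := T3Scales F γ hγ (hγ1.trans (sq_min_one_le _ 𝔠.gamma0_pos)) K) j _)
    have h1 : p.T.Pint j hh W ≤ cP := hPb hh W
    linarith

/-- **THE (47)-MINORANT IS INTEGRABLE AT LEVEL `j` GIVEN THE DATA ROWS THERE** (trivial history only). [cite: Balaban1985UV3, (47) p.267] -/
theorem AlphaInputsT3AC.PkgAt.integrable_low_of_rows (j : ℕ) (hU : Measurable (p.UkH j (Hist.triv (F.P K) j)))
    (hPm : Measurable ((inputOfAC 𝔠.lane p.X p.𝔖).Pint j (Hist.triv (F.P K) j))) (cP : ℝ)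
    (hPb : ∀ U : GaugeField (F.P K) j (Matrix.specialUnitaryGroup (Fin 2) ℂ), (inputOfAC 𝔠.lane p.X p.𝔖).Pint j (Hist.triv (F.P K) j) U ≤ cP) :
    Integrable (fun W => p.T.χ j W * Real.exp (-(p.T.mainT j (Hist.triv (F.P K) j) W) + p.T.Pint j (Hist.triv (F.P K) j) W))
      (fieldMeasure (F.P K) j (Matrix.specialUnitaryGroup (Fin 2) ℂ)) := by
  have hchi : p.T.χ j = chiSmall Set.univ ((inputOfAC 𝔠.lane p.X p.𝔖).ε₁ j) := rfl
  have hmain : ∀ W : GaugeField (F.P K) j (Matrix.specialUnitaryGroup (Fin 2) ℂ), p.T.mainT j (Hist.triv (F.P K) j) W =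
      ((T3Scales F γ hγ (hγ1.trans (sq_min_one_le _ 𝔠.gamma0_pos)) K).gk j)⁻¹ ^ 2 *
        (T3Scales F γ hγ (hγ1.trans (sq_min_one_le _ 𝔠.gamma0_pos)) K).actionEta j (p.UkH j (Hist.triv (F.P K) j) W) := fun _ => rfl
  refine Balaban3D.Proofs.Transport48.integrable_weight_mul_exp ?_ ?_ ?_ ?_ (c := cP) ?_
  · rw [hchi]; exact T4AxialGaugeFixing.measurable_chiSmall _ _
  · intro W; rw [hchi]; unfold chiSmall; split_ifs <;> norm_num
  · intro W; rw [hchi]; unfold chiSmall; split_ifs <;> norm_num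
  · simp_rw [hmain]
    exact (measurable_const.mul ((Bound55Std.measurable_actionEta
      (S := T3Scales F γ hγ (hγ1.trans (sq_min_one_le _ 𝔠.gamma0_pos)) K) j).comp hU)).neg.add hPm
  · intro W
    have h0 : 0 ≤ p.T.mainT j (Hist.triv (F.P K) j) W := by
      rw [hmain]
      exact mul_nonneg (sq_nonneg _) (Bound55Std.actionEta_nonneg (S := T3Scales F γ hγ (hγ1.trans (sq_min_one_le _ 𝔠.gamma0_pos)) K) j _)
    have h1 : p.T.Pint j (Hist.triv (F.P K) j) W ≤ cP := hPb W
    linarith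

end Integrability

/-! ## §1 The datum -/

variable {F : T3Family} {𝔠 : AlphaConsts F.L (suGroupModel 2).N}

/-- **THE VERSION-2 PACKAGE'S DATA ASSEMBLED, WITH PRINT'S (40) SUPPORT AS `Adm`**: run-`K` fields := the objects of the AC tower of the chosen
record `h.pkgAtV2 γ hγ hγ1 K` (as part 2's `dataT3`: histories/regions the lane's, `LF`/`mainT`/`Pint`/`Zterm`/`χ`/`Estep`/`Rm` the tower's,
`Umin := U_k(·,h)`, `Ecst K j := E_j − E`), polymer fields the parameter `π`, and `Adm K j h W := ChargedT3 … (avgWindowFactor L) … j h W` ([Balaban1985UV3]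
(40) p.266, window factor the lane's averaging constant).  A DEFINITION; nothing is asserted. [cite: Balaban1985UV3, (38)-(43) p.266 and (47) p.267] -/
def AlphaInputsT3AC.OfV2.dataT3c (h : AlphaInputsT3AC.OfV2 F 𝔠) (γ : ℝ) (hγ : 0 < γ) (hγ1 : γ ≤ (min 𝔠.gamma0 1) ^ 2)
    (π : AlphaInputsT3AC.PolymerT3 F) : AlphaDataT3 F γ where
  Hist := fun K j => Hist (F.P K) j
  triv := fun K j => Hist.triv (F.P K) j
  Ω := fun K j hh i => Omega 𝔠.lane.carrier.M₁
    (rcolOf (T3Scales F γ hγ (hγ1.trans (sq_min_one_le _ 𝔠.gamma0_pos)) K) 𝔠.lane.carrier) j hh i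
  Adm := fun K j hh W => ChargedT3 F γ 𝔠.b₀ 𝔠.p₀ (avgWindowFactor F.L) K 𝔠.lane.carrier.M₁
    (rcolOf (T3Scales F γ hγ (hγ1.trans (sq_min_one_le _ 𝔠.gamma0_pos)) K) 𝔠.lane.carrier) j hh W
  LF := fun K j W Φ => (h.pkgAtV2 γ hγ hγ1 K).T.LF j W Φ
  Umin := fun K j hh W => (h.pkgAtV2 γ hγ hγ1 K).UkH j hh W
  mainT := fun K j hh W => (h.pkgAtV2 γ hγ hγ1 K).T.mainT j hh W
  Pint := fun K j hh W => (h.pkgAtV2 γ hγ hγ1 K).T.Pint j hh W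
  Loc := π.Loc
  Pterm := π.Pterm
  enl := π.enl
  treeLen := π.treeLen
  Zterm := fun K j hh => (h.pkgAtV2 γ hγ hγ1 K).T.Zterm j hh
  χ := fun K j W => (h.pkgAtV2 γ hγ hγ1 K).T.χ j W
  Estep := fun K i => (h.pkgAtV2 γ hγ hγ1 K).T.Estep i
  Ecst := fun K j => (h.pkgAtV2 γ hγ hγ1 K).T.Ecst j - (h.pkgAtV2 γ hγ hγ1 K).E
  Rm := fun K j => (h.pkgAtV2 γ hγ hγ1 K).T.Rm j

section Delivered

variable (h : AlphaInputsT3AC.OfV2 F 𝔠) (γ : ℝ) (hγ : 0 < γ) (hγ1 : γ ≤ (min 𝔠.gamma0 1) ^ 2) (π : AlphaInputsT3AC.PolymerT3 F)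

/-! ## §2 The minimiser rows delivered (C1, C2, r1 at `n < K`, the main term, `AdmOnSmall`) -/

/-- **`Constraint42Top` — PROVED from r2** ((42) p.266 / (67) p.273 at the top level, torus-iterate form, on print's (40) support).
[cite: Balaban1985UV3, (42) p.266 and (67) p.273] -/
theorem AlphaInputsT3AC.OfV2.dataT3c_constraint42Top : Constraint42Top (h.dataT3c γ hγ hγ1 π) :=
  fun K j hh W hj hadm b hb => (h.pkgAtV2 γ hγ hγ1 K).constraint42 j hj hh W hadm b hb

/-- **`Regularity68Levels` — PROVED from r3** ((68) p.273, multi-level T³ form, on print's (40) support). [cite: Balaban1985UV3, (68) p.273] -/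
theorem AlphaInputsT3AC.OfV2.dataT3c_regularity68Levels : Regularity68Levels (h.dataT3c γ hγ hγ1 π) 𝔠.b₀ 𝔠.p₀ 𝔠.C68 :=
  fun K j hh W hj hadm i hi s hs q hq => (h.pkgAtV2 γ hγ hγ1 K).regularity68Levels j hj hh W hadm i hi s hs q hq

/-- **`Regularity68`** (the `s = 0` instance, `T3AlphaInputsAC.regularity68_of_levels`). [cite: Balaban1985UV3, (68) p.273] -/
theorem AlphaInputsT3AC.OfV2.dataT3c_regularity68 : Regularity68 (h.dataT3c γ hγ hγ1 π) 𝔠.b₀ 𝔠.p₀ 𝔠.C68 :=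
  regularity68_of_levels (h.dataT3c_regularity68Levels γ hγ hγ1 π)

/-- **`MainTermIsAction`** — EXACT (`PkgAt.mainT_eq`: `(1/g_j²)η⁻¹ = β_K`). [cite: Balaban1985UV3, (5) p.256 and (41) p.266] -/
theorem AlphaInputsT3AC.OfV2.dataT3c_mainTermIsAction : MainTermIsAction (h.dataT3c γ hγ hγ1 π) :=
  fun K j hh W => (h.pkgAtV2 γ hγ hγ1 K).toPkgAt.mainT_eq j hh W

/-- **THE `UminTrivIsRegMinimiser` CLAUSES AT A HEIGHT `n < K` — PROVED from r1**: if `θBal(n) ≤ a₁` and `B₃θBal(n) ≤ ε₀ ≤ a₀` (the package's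
constants `OfV2.a₀`/`a₁`, uniform in `γ`, `K`; an adapter discharges these by `T3ThresholdSmallness` once `γ ≤ γ₁(ε₀)`), then for every
`θBal(n)`-small datum `V` the composite minimiser at the trivial history, read `n` levels up, lies in print's space (6) of radius `ε₀` over `V` and
attains `minActionRegPr` there.  (At `n = K` the interface's clause concerns the datum itself — not a minimiser statement, finding F-α1-6.)
[cite: Balaban1985Variational, Thm 1 (8) p.279 and Prop 7 p.299] -/
theorem AlphaInputsT3AC.OfV2.dataT3c_uminTriv (K n : ℕ) (hnK : n < K) (ε₀ : ℝ)
    (ha₁ : θBal F.L γ 𝔠.b₀ 𝔠.p₀ n ≤ h.a₁) (hlo : 𝔠.B₃ * θBal F.L γ 𝔠.b₀ 𝔠.p₀ n ≤ ε₀) (hhi : ε₀ ≤ h.a₀)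
    (V : GaugeField (F.P n) 0 (Matrix.specialUnitaryGroup (Fin 2) ℂ)) (hV : PlaqSmall (θBal F.L γ 𝔠.b₀ 𝔠.p₀ n) V) :
    (h.dataT3c γ hγ hγ1 π).Umin K (K - n) ((h.dataT3c γ hγ hγ1 π).triv K (K - n))
        (fieldShift (F.sitesPerDir_eq (m := F.m) (K := K) (j := K - n) (m' := F.m) (K' := n) (j' := 0) (by omega)) V) ∈
      regFibrePr F n K hnK.le ε₀ V ∧
    wilsonAction4 ((h.dataT3c γ hγ hγ1 π).Umin K (K - n) ((h.dataT3c γ hγ hγ1 π).triv K (K - n))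
        (fieldShift (F.sitesPerDir_eq (m := F.m) (K := K) (j := K - n) (m' := F.m) (K' := n) (j' := 0) (by omega)) V)) =
      minActionRegPr F n K hnK.le ε₀ V := by
  have hθ : 0 < θBal F.L γ 𝔠.b₀ 𝔠.p₀ n := by
    have := (h.pkgAtV2 γ hγ hγ1 K).toPkgAt.θBal_pos (K - n) (by omega)
    rwa [show K - (K - n) = n by omega] at this
  have ha₁' : θBal F.L γ 𝔠.b₀ 𝔠.p₀ n ≤ (h.pkgAtV2 γ hγ hγ1 K).a₁ := by rw [h.pkgAtV2_a₁]; exact ha₁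
  have hhi' : ε₀ ≤ (h.pkgAtV2 γ hγ hγ1 K).a₀ := by rw [h.pkgAtV2_a₀]; exact hhi
  exact ⟨(h.pkgAtV2 γ hγ hγ1 K).uminTriv_mem_regFibrePr hnK hθ ha₁' hlo hhi' V hV,
    (h.pkgAtV2 γ hγ hγ1 K).uminTriv_action_eq hnK hθ ha₁' hlo hhi' V hV⟩

/-- **`AdmOnSmall` AT THE RECORD'S `b₀, p₀` — PROVED**: a `θBal(K − j)`-small datum is charged at the trivial history (the trivial history is
admissible, `Carriers.Hist.admissible_triv`, its top region is the torus, and the route's window sits inside print's (40) window,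
`θBal_le_two_mul_sq_mul_θBal_succ`). [cite: Balaban1985UV3, (40) p.266 and (47) p.267] -/
theorem AlphaInputsT3AC.OfV2.dataT3c_admOnSmall : AdmOnSmall (h.dataT3c γ hγ hγ1 π) 𝔠.b₀ 𝔠.p₀ := by
  intro K j W _ hW
  refine ⟨Hist.admissible_triv _ _ j, fun p _ => (hW p).trans_le ?_⟩
  have hγ1' : γ ≤ 1 := hγ1.trans (sq_min_one_le _ 𝔠.gamma0_pos)
  have hmono := θBal_le_two_mul_sq_mul_θBal_succ (le_of_lt F.hL.2) hγ hγ1' 𝔠.b₀_pos 𝔠.p₀_pos.le (K - j)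
  have hθ : 0 ≤ θBal F.L γ 𝔠.b₀ 𝔠.p₀ (K - j + 1) :=
    (T3MinimiserStabilityReduction.θBal_pos (le_of_lt F.hL.2) hγ hγ1' 𝔠.b₀_pos 𝔠.p₀ (K - j + 1)).le
  have hB : 1 ≤ avgWindowFactor F.L := by
    unfold avgWindowFactor
    have hL : (1 : ℝ) ≤ F.L := by exact_mod_cast (le_of_lt F.hL.2)
    have h5 : (0 : ℝ) ≤ (((3 + 2) * F.L : ℕ) : ℝ) ^ 2 := sq_nonneg _
    nlinarith
  have hL2 : (0 : ℝ) ≤ 2 * (F.L : ℝ) ^ 2 := by positivity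
  calc θBal F.L γ 𝔠.b₀ 𝔠.p₀ (K - j) ≤ 2 * (F.L : ℝ) ^ 2 * θBal F.L γ 𝔠.b₀ 𝔠.p₀ (K - j + 1) := hmono
    _ = 2 * (F.L : ℝ) ^ 2 * 1 * θBal F.L γ 𝔠.b₀ 𝔠.p₀ (K - j + 1) := by ring
    _ ≤ 2 * (F.L : ℝ) ^ 2 * avgWindowFactor F.L * θBal F.L γ 𝔠.b₀ 𝔠.p₀ (K - j + 1) :=
        mul_le_mul_of_nonneg_right (mul_le_mul_of_nonneg_left hB hL2) hθ

/-! ## §3 The sandwich, the characteristic function, the sizes, the bookkeeping -/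

/-- **(41)′ a.e., every `j ≤ K`** (`PkgAt.resDensity_le_ae`). [cite: Balaban1985UV3, (41) p.266 and Thm 2 p.272] -/
theorem AlphaInputsT3AC.OfV2.dataT3c_ineq41AE (K j : ℕ) (hj : j ≤ K) : Ineq41AE (h.dataT3c γ hγ hγ1 π) K j :=
  (h.pkgAtV2 γ hγ hγ1 K).toPkgAt.resDensity_le_ae j hj

/-- **(47)′ a.e., every `j ≤ K`** (`PkgAt.le_resDensity_ae`). [cite: Balaban1985UV3, (47) p.267 and Thm 2 p.272] -/
theorem AlphaInputsT3AC.OfV2.dataT3c_ineq47AE (K j : ℕ) (hj : j ≤ K) : Ineq47AE (h.dataT3c γ hγ hγ1 π) K j :=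
  (h.pkgAtV2 γ hγ hγ1 K).toPkgAt.le_resDensity_ae j hj

/-- **`ChiRange`**. [cite: Balaban1985UV3, (47) p.267] -/
theorem AlphaInputsT3AC.OfV2.dataT3c_chiRange : ChiRange (h.dataT3c γ hγ hγ1 π) := fun K j W =>
  ⟨chi_towerOfAC_nonneg 𝔠.lane (h.pkgAtV2 γ hγ hγ1 K).X (h.pkgAtV2 γ hγ hγ1 K).𝔖 j W,
    chi_towerOfAC_le_one 𝔠.lane (h.pkgAtV2 γ hγ hγ1 K).X (h.pkgAtV2 γ hγ hγ1 K).𝔖 j W⟩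

/-- **`TrivRegions`** (`Carriers.Omega_triv`). [cite: Balaban1985UV3, (47) p.267 and p.272] -/
theorem AlphaInputsT3AC.OfV2.dataT3c_trivRegions : TrivRegions (h.dataT3c γ hγ hγ1 π) := fun _ j i =>
  Omega_triv _ _ j i

/-- **The `EcstBook` identity** (clause (i)): `Ecst K j = −Σ_{i<j} Estep K i` for `j ≤ K`. [cite: Balaban1985UV3, (62) p.271 and (64) p.273] -/
theorem AlphaInputsT3AC.OfV2.dataT3c_Ecst_eq (K j : ℕ) (hj : j ≤ K) :
    (h.dataT3c γ hγ hγ1 π).Ecst K j = -∑ i ∈ Finset.range j, (h.dataT3c γ hγ hγ1 π).Estep K i :=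
  (h.pkgAtV2 γ hγ hγ1 K).toPkgAt.Ecst_sub_E_eq j hj

/-- **`RmSize`** with `C = r⋆γ^{3+κ₀}`, `q = L^{−κ₀}` (closed form `PkgAt.Rm_eq`). [cite: Balaban1985UV3, (41) p.266 and (5) p.256] -/
theorem AlphaInputsT3AC.OfV2.dataT3c_rmSize :
    RmSize (h.dataT3c γ hγ hγ1 π) (𝔠.stepConsts.rstar * γ ^ (3 + 𝔠.κ₀)) (((F.L : ℝ)⁻¹) ^ 𝔠.κ₀) := by
  have hL1 : (1 : ℝ) < F.L := by exact_mod_cast F.hL.2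
  have hLi : (0 : ℝ) ≤ (F.L : ℝ)⁻¹ := inv_nonneg.mpr (zero_lt_one.trans hL1).le
  have hq0 : 0 ≤ ((F.L : ℝ)⁻¹) ^ 𝔠.κ₀ := Real.rpow_nonneg hLi _
  refine ⟨hq0, Real.rpow_lt_one hLi (inv_lt_one_of_one_lt₀ hL1) 𝔠.κ₀_pos, fun K j hj => ?_⟩
  have heq : (h.dataT3c γ hγ hγ1 π).Rm K j = 𝔠.stepConsts.rstar * γ ^ (3 + 𝔠.κ₀) *
      (∑ i ∈ Finset.range j, (((F.L : ℝ)⁻¹) ^ 𝔠.κ₀) ^ (K - i)) * (2 * (F.L : ℝ) ^ F.m) ^ 3 :=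
    (h.pkgAtV2 γ hγ hγ1 K).toPkgAt.Rm_eq j hj
  refine ⟨?_, heq.le⟩
  rw [heq]
  have h3 : 0 ≤ ∑ i ∈ Finset.range j, (((F.L : ℝ)⁻¹) ^ 𝔠.κ₀) ^ (K - i) := Finset.sum_nonneg fun i _ => pow_nonneg hq0 _
  have h4 : 0 ≤ (2 * (F.L : ℝ) ^ F.m) ^ 3 := by positivity
  exact mul_nonneg (mul_nonneg (mul_nonneg 𝔠.stepConsts.rstar_nonneg (Real.rpow_nonneg hγ.le _)) h3) h4

/-- **`χ_j` IS THE INDICATOR OF THE ROUTE'S WINDOW** (`PkgAt.eps1_eq`): `χ^{(K)}_j = chiSmall univ (θBal (K − j))`, `j ≤ K`.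
[cite: Balaban1985UV3, (47) p.267] -/
theorem AlphaInputsT3AC.OfV2.dataT3c_chi_eq (K j : ℕ) (hj : j ≤ K) (W : GaugeField (F.P K) j (Matrix.specialUnitaryGroup (Fin 2) ℂ)) :
    (h.dataT3c γ hγ hγ1 π).χ K j W = chiSmall Set.univ (θBal F.L γ 𝔠.b₀ 𝔠.p₀ (K - j)) W := by
  rw [← (h.pkgAtV2 γ hγ hγ1 K).toPkgAt.eps1_eq j hj]
  rfl

/-- **`NoTrivOnLarge` clause 1 with `Cχ = 1`**: one plaquette at distance `≥ θBal(K − j)` from `1` kills `χ_j`. [cite: Balaban1985UV3, (47) p.267] -/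
theorem AlphaInputsT3AC.OfV2.dataT3c_chi_eq_zero_of_le (K j : ℕ) (hj : j ≤ K)
    (W : GaugeField (F.P K) j (Matrix.specialUnitaryGroup (Fin 2) ℂ)) (q : Plaq (F.P K) j)
    (hq : 1 * θBal F.L γ 𝔠.b₀ 𝔠.p₀ (K - j) ≤ GaugeGroup.dist1 (GaugeField.plaqHol W q)) :
    (h.dataT3c γ hγ hγ1 π).χ K j W = 0 := by
  rw [h.dataT3c_chi_eq γ hγ hγ1 π K j hj W]
  unfold chiSmall
  rw [if_neg]
  intro hsmall
  have hlt := hsmall q (Set.mem_univ q)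
  linarith

/-- On the window the minorant is positive: `0 < low_j(W)` for `θBal(K − j)`-small `W`. [cite: Balaban1985UV3, (47) p.267] -/
theorem AlphaInputsT3AC.OfV2.dataT3c_low_pos_of_plaqSmall (K j : ℕ) (hj : j ≤ K)
    (W : GaugeField (F.P K) j (Matrix.specialUnitaryGroup (Fin 2) ℂ)) (hW : PlaqSmall (θBal F.L γ 𝔠.b₀ 𝔠.p₀ (K - j)) W) :
    0 < (h.dataT3c γ hγ hγ1 π).low K j W := by
  unfold AlphaDataT3.low
  rw [h.dataT3c_chi_eq γ hγ hγ1 π K j hj W]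
  unfold chiSmall
  rw [if_pos (show PlaqSmallOn Set.univ (θBal F.L γ 𝔠.b₀ 𝔠.p₀ (K - j)) W from fun q _ => hW q), one_mul]
  exact Real.exp_pos _

/-! ## §4 `EnvelopeRegular` AT EVERY `j ≤ K` (step rows below the top, terminal rows at the top) -/

/-- **`up_j` integrable, every `j ≤ K`**. [cite: Balaban1985UV3, (41) p.266] -/
theorem AlphaInputsT3AC.OfV2.dataT3c_integrable_up (K j : ℕ) (hj : j ≤ K) :
    Integrable ((h.dataT3c γ hγ hγ1 π).up K j) (fieldMeasure (F.P K) j (Matrix.specialUnitaryGroup (Fin 2) ℂ)) := by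
  show Integrable (fun W => ∑ hh : Hist (F.P K) j,
    (inputOfAC 𝔠.lane (h.pkgAtV2 γ hγ hγ1 K).X (h.pkgAtV2 γ hγ hγ1 K).𝔖).W.mass j hh W *
      Real.exp (-((h.pkgAtV2 γ hγ hγ1 K).T.mainT j hh W) + (h.pkgAtV2 γ hγ hγ1 K).T.Pint j hh W +
        (h.pkgAtV2 γ hγ hγ1 K).T.Zterm j hh)) _
  rcases Nat.lt_or_eq_of_le hj with hlt | heq
  · have st := (h.pkgAtV2 γ hγ hγ1 K).run.steps j hlt
    exact (h.pkgAtV2 γ hγ hγ1 K).toPkgAt.integrable_up_of_rows j st.hU st.hPm _ st.hPb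
  · subst heq
    exact (h.pkgAtV2 γ hγ hγ1 j).toPkgAt.integrable_up_of_rows j (h.pkgAtV2 γ hγ hγ1 j).terminal_measurable_UkH
      (h.pkgAtV2 γ hγ hγ1 j).terminal_measurable_Pint _ (h.pkgAtV2 γ hγ hγ1 j).terminal_Pint_le

/-- **`low_j` integrable, every `j ≤ K`**. [cite: Balaban1985UV3, (47) p.267] -/
theorem AlphaInputsT3AC.OfV2.dataT3c_integrable_low (K j : ℕ) (hj : j ≤ K) :
    Integrable ((h.dataT3c γ hγ hγ1 π).low K j) (fieldMeasure (F.P K) j (Matrix.specialUnitaryGroup (Fin 2) ℂ)) := by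
  show Integrable (fun W => (h.pkgAtV2 γ hγ hγ1 K).T.χ j W *
    Real.exp (-((h.pkgAtV2 γ hγ hγ1 K).T.mainT j (Hist.triv (F.P K) j) W) +
      (h.pkgAtV2 γ hγ hγ1 K).T.Pint j (Hist.triv (F.P K) j) W)) _
  rcases Nat.lt_or_eq_of_le hj with hlt | heq
  · have st := (h.pkgAtV2 γ hγ hγ1 K).run.steps j hlt
    exact (h.pkgAtV2 γ hγ hγ1 K).toPkgAt.integrable_low_of_rows j (st.hU _) (st.hPm _) _ (st.hPb _)
  · subst heq
    exact (h.pkgAtV2 γ hγ hγ1 j).toPkgAt.integrable_low_of_rows j ((h.pkgAtV2 γ hγ hγ1 j).terminal_measurable_UkH _)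
      ((h.pkgAtV2 γ hγ hγ1 j).terminal_measurable_Pint _) _ ((h.pkgAtV2 γ hγ hγ1 j).terminal_Pint_le _)

/-- **`0 < ∫ low_j`, every `j ≤ K`** (open non-empty charged window + `IsOpenPosMeasure` of product Haar measure, part 4). [cite: Balaban1985UV3, (47) p.267] -/
theorem AlphaInputsT3AC.OfV2.dataT3c_integral_low_pos (K j : ℕ) (hj : j ≤ K) :
    0 < ∫ W, (h.dataT3c γ hγ hγ1 π).low K j W ∂fieldMeasure (F.P K) j (Matrix.specialUnitaryGroup (Fin 2) ℂ) := by
  have hχ := h.dataT3c_chiRange γ hγ hγ1 π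
  rw [integral_pos_iff_support_of_nonneg_ae (ae_of_all _ fun W => low_nonneg hχ K j W) (h.dataT3c_integrable_low γ hγ hγ1 π K j hj)]
  have hθ : 0 < θBal F.L γ 𝔠.b₀ 𝔠.p₀ (K - j) := (h.pkgAtV2 γ hγ hγ1 K).toPkgAt.θBal_pos j hj
  refine lt_of_lt_of_le (fieldMeasure_plaqSmall_pos (P := F.P K) (j := j) hθ) (measure_mono fun W hW => ?_)
  exact Function.mem_support.mpr (ne_of_gt (h.dataT3c_low_pos_of_plaqSmall γ hγ hγ1 π K j hj W hW))

/-- **`EnvelopeRegular` AT EVERY LEVEL `j ≤ K`** — the interface's regularity clause IN FULL for the version-2 datum (part 4 stopped at `j < K`;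
the terminal rows supply the top level). [cite: Balaban1985UV3, (41) p.266 and (47) p.267] -/
theorem AlphaInputsT3AC.OfV2.dataT3c_envelopeRegular (K j : ℕ) (hj : j ≤ K) : EnvelopeRegular (h.dataT3c γ hγ hγ1 π) K j :=
  ⟨h.dataT3c_integrable_low γ hγ hγ1 π K j hj, h.dataT3c_integrable_up γ hγ hγ1 π K j hj, h.dataT3c_integral_low_pos γ hγ hγ1 π K j hj⟩

/-- **THE PACKAGE'S SANDWICH-AND-REGULARITY CLAUSE IN FULL**: `∀ K j, j ≤ K → Ineq41AE ∧ Ineq47AE ∧ EnvelopeRegular` for the version-2 datum.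
[cite: Balaban1985UV3, Thm 2 p.272] -/
theorem AlphaInputsT3AC.OfV2.dataT3c_sandwich_regular (K j : ℕ) (hj : j ≤ K) :
    Ineq41AE (h.dataT3c γ hγ hγ1 π) K j ∧ Ineq47AE (h.dataT3c γ hγ hγ1 π) K j ∧ EnvelopeRegular (h.dataT3c γ hγ hγ1 π) K j :=
  ⟨h.dataT3c_ineq41AE γ hγ hγ1 π K j hj, h.dataT3c_ineq47AE γ hγ hγ1 π K j hj, h.dataT3c_envelopeRegular γ hγ hγ1 π K j hj⟩

end Delivered

end Summit.QuantumFields.YangMills.Theorems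

end
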